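import Mathlib
import HarnessLib
import Summits.AtomisticToContinuum.Crystallization.Theorems.PricedLinkCensusSoftLayerPropagationOneStackingMapSearchDefs
import Summits.AtomisticToContinuum.Crystallization.Theorems.PricedLinkCensusSoftLayerPropagationOneStackingMapSearchBasic
import Summits.AtomisticToContinuum.Crystallization.Theorems.PricedLinkCensusSoftLayerPropagationOneStackingMapRealizes

/-!
# One-stacking map engine: soundness of slot linking

Route `PricedLinkCensus`, crux `SoftLayerPropagation` (stmt-AtomisticToContinuum-14233), line
`Sketch`, stub `stub_oneStackingMap`.  **`linkSlots_sound`**: if the cursor site `j` of a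
realized state has the exact star `V` (both inclusions, unit vectors), then SOME branch of
`St.linkSlots j vs s` is realized (by an extension of the site map), keeps the old sites, their
positions and the recorded bonds of `j`, and records for every slot `v ∈ vs` a neighbour of `j` at
`pos j + v`.  The branch is dictated by the development: a slot already recorded is skipped; the
occupant is forced when an expanded recorded neighbour of `j` records it (bonds among neighbours =
unit distances); otherwise it is the represented occupant, which is admissible (an expanded or
saturated or already-bonded occupant would have recorded the bond), or a new site.  [folklore]
-/

noncomputable section

namespace Summit.AtomisticToContinuum.Crystallization.Theorems

namespace OneStacking

open V3

namespace St

variable (j : ℕ) (v : V3) (vs : List V3) (s : St)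

/-- The forced occupants of the slot `pos j + v`. [folklore] -/
def forcedAt : List ℕ :=
  (s.findAt (V3.add (s.pos j) v)).filter fun k => (s.nbrs j).any fun m => m < s.cur && (s.nbrs m).contains k

/-- The admissible optional occupants of the slot `pos j + v`. [folklore] -/
def optsAt : List ℕ :=
  (s.findAt (V3.add (s.pos j) v)).filter fun k => ¬ k < s.cur ∧ (s.nbrs k).length < 12 ∧ ¬ (s.nbrs k).contains j

/-- Unfolding `linkSlots` on a recorded slot. [folklore] -/
theorem linkSlots_cons_skip (h : ((s.nbrs j).any fun b => decide (s.pos b = V3.add (s.pos j) v)) = true) :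
    linkSlots j (v :: vs) s = linkSlots j vs s := by
  rw [linkSlots]; simp only [h, if_true]

/-- Unfolding `linkSlots` on a slot with two forced occupants. [folklore] -/
theorem linkSlots_cons_two (h : ((s.nbrs j).any fun b => decide (s.pos b = V3.add (s.pos j) v)) = false)
    {k k2 : ℕ} {rest : List ℕ} (hf : forcedAt j v s = k :: k2 :: rest) : linkSlots j (v :: vs) s = [] := by
  rw [linkSlots]; simp only [h]; unfold forcedAt at hf; simp only [hf]; rfl

/-- Unfolding `linkSlots` on a slot with one forced occupant. [folklore] -/
theorem linkSlots_cons_one (h : ((s.nbrs j).any fun b => decide (s.pos b = V3.add (s.pos j) v)) = false)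
    {k : ℕ} (hf : forcedAt j v s = [k]) : linkSlots j (v :: vs) s =
      if k < s.cur ∨ 12 ≤ (s.nbrs k).length ∨ (s.nbrs k).contains j then [] else linkSlots j vs (s.link j k) := by
  rw [linkSlots]; simp only [h]; unfold forcedAt at hf; simp only [hf]; rfl

/-- Unfolding `linkSlots` on a slot without forced occupant. [folklore] -/
theorem linkSlots_cons_none (h : ((s.nbrs j).any fun b => decide (s.pos b = V3.add (s.pos j) v)) = false)
    (hf : forcedAt j v s = []) : linkSlots j (v :: vs) s =
      (((s.push (V3.add (s.pos j) v) (s.lvl j + 1)).link j s.size) :: (optsAt j v s).map fun k => s.link j k).flatMap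
        (linkSlots j vs) := by
  rw [linkSlots]; simp only [h]; unfold forcedAt at hf; simp only [hf]; rfl

/-- Membership in `forcedAt`. [folklore] -/
theorem mem_forcedAt {k : ℕ} : k ∈ forcedAt j v s ↔
    (k < s.size ∧ s.pos k = V3.add (s.pos j) v) ∧ ∃ m ∈ s.nbrs j, m < s.cur ∧ k ∈ s.nbrs m := by
  simp [forcedAt, List.mem_filter, mem_findAt, List.any_eq_true]

/-- Membership in `optsAt`. [folklore] -/
theorem mem_optsAt {k : ℕ} : k ∈ optsAt j v s ↔
    (k < s.size ∧ s.pos k = V3.add (s.pos j) v) ∧ ¬ k < s.cur ∧ (s.nbrs k).length < 12 ∧ j ∉ s.nbrs k := by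
  simp [optsAt, List.mem_filter, mem_findAt]

/-- `forcedAt` has no repetition. [folklore] -/
theorem nodup_forcedAt : (forcedAt j v s).Nodup :=
  ((List.nodup_range).filter _).filter _

/-- A recorded slot, read off `any`. [folklore] -/
theorem any_pos_eq_true {p : V3} {b : ℕ} (hb : b ∈ s.nbrs j) (hp : s.pos b = p) :
    ((s.nbrs j).any fun b => decide (s.pos b = p)) = true :=
  List.any_eq_true.2 ⟨b, hb, by simp [hp]⟩

end St

/-! ### The occupant of a slot -/

section Occupant

variable {A : Dev} {s : St} {emb : ℕ → Fin A.N} {j : ℕ} {v p : V3} {y : Fin A.N}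

/-- **A represented occupant of an unrecorded slot is unexpanded, unsaturated and not bonded to
`j`** (each would have recorded the bond at `j`). [folklore] -/
theorem occupant_admissible (hR : RealizedBy A s emb) (hjs : j < s.size)
    (hy : A.G.Adj (emb j) y) (hyp : A.pos y = toE3 p)
    (hany : ((s.nbrs j).any fun b => decide (s.pos b = p)) = false)
    {c : ℕ} (hc : c < s.size) (hcy : emb c = y) :
    ¬ c < s.cur ∧ (s.nbrs c).length < 12 ∧ j ∉ s.nbrs c := by
  have hpc : s.pos c = p := toE3_injective (by rw [← hR.posE c hc, hcy, hyp])
  -- if `c` recorded `j`, then `j` recorded `c`: contradiction with `hany`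
  have key : j ∉ s.nbrs c := by
    intro hjc
    have hcj : c ∈ s.nbrs j := hR.symm c hc j hjc
    have := St.any_pos_eq_true j s hcj hpc
    rw [this] at hany; exact Bool.noConfusion hany
  have hyc : A.G.Adj (emb c) (emb j) := by rw [hcy]; exact hy.symm
  refine ⟨fun hcc => key ?_, ?_, key⟩
  · obtain ⟨b, hb, hbe⟩ := hR.doneE c hcc (emb j) hyc
    rwa [hR.inj b j (hR.adj hb).2.1 hjs hbe] at hb
  · by_contra hlen
    obtain ⟨b, hb, hbe⟩ := hR.saturated hc (not_lt.1 hlen) hyc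
    rw [hR.inj b j (hR.adj hb).2.1 hjs hbe] at hb
    exact key hb

/-- **A forced occupant is the true occupant** (bonds among the neighbours of an expanded site are
the unit shadow distances). [folklore] -/
theorem forced_eq (hR : RealizedBy A s emb) (hjs : j < s.size)
    (hjball : ∃ w : A.G.Walk A.i (emb j), w.length ≤ 4)
    (hy : A.G.Adj (emb j) y) (hyp : A.pos y = toE3 (V3.add (s.pos j) v)) (hvu : V3.n2 v = NN2)
    {k : ℕ} (hk : k ∈ St.forcedAt j v s) : k < s.size ∧ emb k = y := by
  rw [St.mem_forcedAt] at hk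
  obtain ⟨⟨hks, hkp⟩, m, hmj, hmc, hkm⟩ := hk
  refine ⟨hks, ?_⟩
  obtain ⟨hms, hjm⟩ := (hR.nbrE j hjs m hmj)
  obtain ⟨-, hmk⟩ := (hR.nbrE m hms k hkm)
  -- `j` and `k` are neighbours of the expanded `m`, at unit shadow distance: hence bonded
  have hball : ∃ w : A.G.Walk A.i (emb m), w.length ≤ 4 := A.ball_mono (hR.lvl4 m hmc) (hR.lvlE m hms)
  have hdist : ‖A.pos (emb j) - A.pos (emb k)‖ ^ 2 = 2 := by
    rw [hR.posE j hjs, hR.posE k hks, hkp, toE3_add, sub_add_cancel_left, norm_neg]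
    exact (norm_toE3_sq_eq_two_iff v).2 hvu
  have hjk : A.G.Adj (emb j) (emb k) := (A.adj_iff (emb m) hball (emb j) (emb k) hjm.symm hmk).2 hdist
  exact A.star_inj (emb j) hjball (emb k) y hjk hy (by rw [hR.posE k hks, hkp, hyp])

end Occupant

/-! ### The linking induction -/

/-- **Soundness of `linkSlots`** (see the file header).  The invariant: the state is realized,
`j` is the cursor, of level `≤ 4`, and `V` is its exact star (both inclusions, unit vectors).
[folklore] -/
theorem linkSlots_sound (A : Dev) (V : List V3) (j : ℕ)
    (hVu : ∀ v ∈ V, V3.n2 v = NN2) :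
    ∀ (vs : List V3) (s : St) (emb : ℕ → Fin A.N), RealizedBy A s emb → j = s.cur → s.cur < s.size →
      s.lvl j ≤ 4 →
      (∀ k, A.G.Adj (emb j) k → ∃ v ∈ V, A.pos k = A.pos (emb j) + toE3 v) →
      (∀ v ∈ V, ∃ k, A.G.Adj (emb j) k ∧ A.pos k = A.pos (emb j) + toE3 v) →
      vs ⊆ V →
      ∃ s1 ∈ St.linkSlots j vs s, ∃ emb1 : ℕ → Fin A.N, Nonempty (RealizedBy A s1 emb1) ∧
        s1.cur = s.cur ∧ s.size ≤ s1.size ∧ s1.lvl j = s.lvl j ∧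
        (∀ a, a < s.size → s1.pos a = s.pos a ∧ emb1 a = emb a) ∧
        (∀ b, b ∈ s.nbrs j → b ∈ s1.nbrs j) ∧
        (∀ v ∈ vs, ∃ b ∈ s1.nbrs j, s1.pos b = V3.add (s.pos j) v) := by
  intro vs
  induction vs with
  | nil =>
    intro s emb hR hj hcur hl hV1 hV2 hsub
    exact ⟨s, by simp [St.linkSlots], emb, ⟨hR⟩, rfl, le_rfl, rfl, fun a _ => ⟨rfl, rfl⟩, fun b hb => hb,
      fun v hv => by cases hv⟩
  | cons v vs ih =>
    intro s emb hR hj hcur hl hV1 hV2 hsub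
    have hjs : j < s.size := by rw [hj]; exact hcur
    have hvV : v ∈ V := hsub List.mem_cons_self
    have hsub' : vs ⊆ V := fun w hw => hsub (List.mem_cons_of_mem _ hw)
    have hjball : ∃ w : A.G.Walk A.i (emb j), w.length ≤ 4 := A.ball_mono hl (hR.lvlE j hjs)
    set p := V3.add (s.pos j) v with hp
    -- the true occupant
    obtain ⟨y, hy, hyp⟩ := hV2 v hvV
    rw [hR.posE j hjs, ← toE3_add] at hyp
    -- helper: assembling the conclusion from a branch state `t` realized by `embt` that keeps the old data
    have assemble : ∀ (t : St) (embt : ℕ → Fin A.N) (L : List St), RealizedBy A t embt → j = t.cur → t.cur < t.size →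
        t.lvl j = s.lvl j → t.cur = s.cur → s.size ≤ t.size →
        (∀ a, a < s.size → t.pos a = s.pos a ∧ embt a = emb a) → (∀ b, b ∈ s.nbrs j → b ∈ t.nbrs j) →
        (∃ b ∈ t.nbrs j, t.pos b = p) → St.linkSlots j vs t ⊆ L →
        ∃ s1 ∈ L, ∃ emb1 : ℕ → Fin A.N, Nonempty (RealizedBy A s1 emb1) ∧
          s1.cur = s.cur ∧ s.size ≤ s1.size ∧ s1.lvl j = s.lvl j ∧
          (∀ a, a < s.size → s1.pos a = s.pos a ∧ emb1 a = emb a) ∧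
          (∀ b, b ∈ s.nbrs j → b ∈ s1.nbrs j) ∧
          (∀ w ∈ v :: vs, ∃ b ∈ s1.nbrs j, s1.pos b = V3.add (s.pos j) w) := by
      intro t embt L hRt hjt hcurt hlt hct hst hkeep hnb hcov hL
      have hjt' : j < t.size := by rw [hjt]; exact hcurt
      have hV1t : ∀ k, A.G.Adj (embt j) k → ∃ v ∈ V, A.pos k = A.pos (embt j) + toE3 v := by
        rw [(hkeep j hjs).2]; exact hV1
      have hV2t : ∀ v ∈ V, ∃ k, A.G.Adj (embt j) k ∧ A.pos k = A.pos (embt j) + toE3 v := by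
        rw [(hkeep j hjs).2]; exact hV2
      obtain ⟨s1, hs1, emb1, ⟨hR1⟩, hc1, hsz1, hl1, hkeep1, hnb1, hcov1⟩ :=
        ih t embt hRt hjt hcurt (hlt ▸ hl) hV1t hV2t hsub'
      refine ⟨s1, hL hs1, emb1, ⟨hR1⟩, hc1.trans hct, hst.trans hsz1, hl1.trans hlt, fun a ha => ?_,
        fun b hb => hnb1 b (hnb b hb), ?_⟩
      · obtain ⟨h1, h2⟩ := hkeep1 a (lt_of_lt_of_le ha hst)
        obtain ⟨h3, h4⟩ := hkeep a ha
        exact ⟨h1.trans h3, h2.trans h4⟩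
      · intro w hw
        rcases List.mem_cons.1 hw with rfl | hw
        · obtain ⟨b, hb, hbp⟩ := hcov
          refine ⟨b, hnb1 b hb, ?_⟩
          rw [(hkeep1 b (hRt.adj hb).2.1).1, hbp]
        · obtain ⟨b, hb, hbp⟩ := hcov1 w hw
          exact ⟨b, hb, by rw [hbp, (hkeep j hjs).1]⟩
    by_cases hany : ((s.nbrs j).any fun b => decide (s.pos b = p)) = true
    · -- the slot is already recorded
      rw [St.linkSlots_cons_skip j v vs s hany]
      obtain ⟨b, hb, hbp⟩ := List.any_eq_true.1 hany
      exact assemble s emb _ hR hj hcur rfl rfl le_rfl (fun a _ => ⟨rfl, rfl⟩) (fun b hb => hb)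
        ⟨b, hb, of_decide_eq_true hbp⟩ (fun x hx => hx)
    rw [Bool.not_eq_true] at hany
    -- a represented occupant is admissible; it realizes the link
    have hlinkc : ∀ c, c < s.size → emb c = y → c ∈ St.optsAt j v s ∧ Nonempty (RealizedBy A (s.link j c) emb) := by
      intro c hc hcy
      obtain ⟨h1, h2, h3⟩ := occupant_admissible hR hjs hy hyp hany hc hcy
      have hpc : s.pos c = p := toE3_injective (by rw [← hR.posE c hc, hcy, hyp])
      have hcj : c ∉ s.nbrs j := fun hcj => by
        have := St.any_pos_eq_true j s hcj hpc; rw [this] at hany; exact Bool.noConfusion hany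
      refine ⟨(St.mem_optsAt j v s).2 ⟨⟨hc, hpc⟩, h1, h2, h3⟩, ⟨hR.link hjs hc (hcy ▸ hy) hcj h3 (le_of_eq hj.symm) (not_lt.1 h1)⟩⟩
    rcases hf : St.forcedAt j v s with _ | ⟨k, _ | ⟨k2, rest⟩⟩
    · -- no forced occupant
      rw [St.linkSlots_cons_none j v vs s hany hf]
      by_cases hrep : ∃ c, c < s.size ∧ emb c = y
      · -- the occupant is represented: the optional link to it
        obtain ⟨c, hc, hcy⟩ := hrep
        obtain ⟨hopt, ⟨hRc⟩⟩ := hlinkc c hc hcy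
        refine assemble (s.link j c) emb _ hRc (by simpa using hj) (by simpa using hcur) (by simp) (by simp) (by simp)
          (fun a _ => ⟨St.pos_link s j c a, rfl⟩)
          (fun b hb => (St.mem_nbrs_link s hjs hc j b).2 (Or.inl hb))
          ⟨c, (St.mem_nbrs_link s hjs hc j c).2 (Or.inr (Or.inl ⟨rfl, rfl⟩)),
            by rw [St.pos_link]; exact toE3_injective (by rw [← hR.posE c hc, hcy, hyp])⟩ ?_
        intro x hx
        rw [List.mem_flatMap]
        exact ⟨s.link j c, List.mem_cons_of_mem _ (List.mem_map.2 ⟨c, hopt, rfl⟩), hx⟩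
      · -- a new site
        push Not at hrep
        set fresh := (s.push p (s.lvl j + 1)).link j s.size with hfresh
        set emb' : ℕ → Fin A.N := fun c => if c = s.size then y else emb c with hemb'
        have hRf : RealizedBy A fresh emb' := hR.pushLink hjs (le_of_eq hj.symm) hl hy hrep hyp
        have hszp : (s.push p (s.lvl j + 1)).size = s.size + 1 := St.size_push s _ _
        have hjs' : j < (s.push p (s.lvl j + 1)).size := by rw [hszp]; omega
        have hss' : s.size < (s.push p (s.lvl j + 1)).size := by rw [hszp]; omega
        have hjne : j ≠ s.size := Nat.ne_of_lt hjs
        refine assemble fresh emb' _ hRf (by simp [hfresh, hj]) (by simp [hfresh, hszp]; omega)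
          (by simp [hfresh, St.lvl_push, hjs]) (by simp [hfresh]) (by simp [hfresh, hszp])
          (fun a ha => ⟨by simp [hfresh, St.pos_push, ha], by simp [hemb', Nat.ne_of_lt ha]⟩)
          (fun b hb => (St.mem_nbrs_link _ hjs' hss' j b).2 (Or.inl (by rw [St.nbrs_push, if_pos hjs]; exact hb)))
          ⟨s.size, (St.mem_nbrs_link _ hjs' hss' j s.size).2 (Or.inr (Or.inl ⟨rfl, rfl⟩)),
            by simp [hfresh, St.pos_push]⟩ ?_
        intro x hx
        rw [List.mem_flatMap]
        exact ⟨fresh, List.mem_cons_self, hx⟩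
    · -- one forced occupant: it is the true occupant, and the link to it is taken
      obtain ⟨hks, hky⟩ := forced_eq hR hjs hjball hy hyp (hVu v hvV) (by rw [hf]; exact List.mem_cons_self)
      obtain ⟨hopt, ⟨hRk⟩⟩ := hlinkc k hks hky
      obtain ⟨-, h1, h2, h3⟩ := (St.mem_optsAt j v s).1 hopt
      rw [St.linkSlots_cons_one j v vs s hany hf, if_neg (by push Not; exact ⟨not_lt.1 h1, h2, fun h => h3 (List.contains_iff_mem.1 h)⟩)]
      exact assemble (s.link j k) emb _ hRk (by simpa using hj) (by simpa using hcur) (by simp) (by simp) (by simp)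
        (fun a _ => ⟨St.pos_link s j k a, rfl⟩)
        (fun b hb => (St.mem_nbrs_link s hjs hks j b).2 (Or.inl hb))
        ⟨k, (St.mem_nbrs_link s hjs hks j k).2 (Or.inr (Or.inl ⟨rfl, rfl⟩)),
          by rw [St.pos_link]; exact toE3_injective (by rw [← hR.posE k hks, hky, hyp])⟩ (fun x hx => hx)
    · -- two forced occupants: impossible
      exfalso
      have hk1 : k ∈ St.forcedAt j v s := by rw [hf]; exact List.mem_cons_self
      have hk2 : k2 ∈ St.forcedAt j v s := by rw [hf]; exact List.mem_cons_of_mem _ List.mem_cons_self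
      obtain ⟨hks, hky⟩ := forced_eq hR hjs hjball hy hyp (hVu v hvV) hk1
      obtain ⟨hk2s, hk2y⟩ := forced_eq hR hjs hjball hy hyp (hVu v hvV) hk2
      have hne : k ≠ k2 := by
        have hnd := St.nodup_forcedAt j v s
        rw [hf, List.nodup_cons] at hnd
        exact fun h => hnd.1 (h ▸ List.mem_cons_self)
      exact hne (hR.inj k k2 hks hk2s (hky.trans hk2y.symm))

end OneStacking



end Summit.AtomisticToContinuum.Crystallization.Theorems
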